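import Summits.ResolutionOfSingularities.ResolutionOfSingularities.Theorems.FrobeniusClosingPatchingRelPerfectDepthFlagSepCompositions
import Summits.ResolutionOfSingularities.ResolutionOfSingularities.Theorems.FrobeniusClosingPatchingRelPerfectDepthTwoSeparation
import Literature.AlgebraicGeometry.Resolution.ControlledTransformBaseChange
import HarnessLib

/-!
# Chain W5.2 — F6 stage 1, E-side: the DIAGONAL of the flag format (one-ideal currency for the residual
# `LegalDivisorReduction₃` / `LegalScopedDivisorReduction₃`)

[OURS · L1 W5.2 · res-D-pv-016 AS res-L1-w52-stub-5; support for res-L1-w52-idea-1's T6-E1b residual (res-L1-w52-plan-1 RULING R3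
2026-08-27T11:27:37Z).]  NOT statements of the manuscript under review; AI-written, weaker than expert review; fact-free.

The residual `LegalDivisorReduction₃` (idea-1, Sketch v9 §9 (9e)) is the DIAGONAL instance `𝔟 = R₁ = H` of the stage-1 flag driver:
`IsFlagSeq ρ H H 𝔟' R₁'` with `EndFlag 𝔟' R₁'`.  On the diagonal the flag carries no information beyond its first term — the
second term stays equal to the first (`IsFlagSeq.right_eq_of_diag`), legality is `H_k ≤ 𝓘_C²` alone, and `EndFlag H' H'` reads
`ord H' ≤ 1` everywhere (`endFlag_self_iff`).  Conversely every PURE WEIGHT-TWO sequence (`IsPureWeightedSeq 2 ρ H H'`: regular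
centres `C` with `H_k ≤ 𝓘_C²`, transform `τᶜ(·, 2)`) is a diagonal flag sequence (`IsFlagSeq.of_isPureWeightedSeq`).  So the
provers of the residual (phase 1 = CJS transport truncated at the first regular stage, the even-multiplicity PEEL, phase 2 =
separation) may work in the one-ideal currency «`IsPureWeightedSeq 2` + `∀ x, idealOrder H' x ≤ 1`» and convert once:
`exists_isFlagSeq_endFlag_of_isPureWeightedSeq`.

Bricks: `IsBlowup.pow_mul_controlledTransform_eq` (BGMW Lemma 3.2.1 (2)), `colon_pow_eq_of_mul_eq` (cancellation of the
exceptional Cartier divisor), whence `τᶜ(H, 1) = 𝓘_exc · τᶜ(H, 2) ≤ τᶜ(H, 2)` for `H ≤ 𝓘_C²`.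
[cite: BierstoneGrigorievMilmanWlodarczyk2011, Def. 3.1.3, §3.2 Lemma 3.2.1] [cite: KawanoueMatsuki2016, §2]
-/

-- `Summit.<Summit>.<Sub>.Theorems` with `Sub = Summit` (single-conjunct summit, D-0017)
set_option linter.dupNamespace false

noncomputable section

open CategoryTheory CategoryTheory.Limits AlgebraicGeometry TopologicalSpace
open Literature.AlgebraicGeometry.Resolution
open Scheme.IdealSheafData

namespace Summit.ResolutionOfSingularities.ResolutionOfSingularities.Theorems.DepthTargets

universe u

/-- **Weight one versus weight two on a weight-two-permissible centre**: if `H ≤ 𝓘_C²` and `τ` blows up `C`, then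
`τᶜ(H, 1) = 𝓘_exc · τᶜ(H, 2)` — the weight-one transform still carries one copy of the exceptional divisor.
[cite: BierstoneGrigorievMilmanWlodarczyk2011, §3.2 Lemma 3.2.1] -/
theorem controlledTransform_one_eq_exc_mul_two {E' E : Scheme.{u}} {τ : E' ⟶ E} {C H : E.IdealSheafData}
    (hτ : IsBlowup τ C) (hle : H ≤ C ^ 2) :
    controlledTransform τ C H 1 = C.comap τ * controlledTransform τ C H 2 := by
  have hD := hτ.isEffectiveCartier
  have h2 : H.comap τ ≤ C.comap τ ^ 2 := by
    have h : H.comap τ ≤ (C ^ 2).comap τ := Scheme.IdealSheafData.comap_mono (f := τ) hle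
    rwa [comap_pow] at h
  have heq := hτ.pow_mul_controlledTransform_eq h2
  -- `τᶜ(H, 1) = (τ^*H : 𝓘_exc)` and `𝓘_exc · (𝓘_exc · τᶜ(H, 2)) = τ^*H`
  refine colon_pow_eq_of_mul_eq hD ?_
  rw [pow_one, ← mul_assoc, ← sq, heq]

/-- On a weight-two-permissible centre the weight-one transform is contained in the weight-two transform:
`τᶜ(H, 1) ≤ τᶜ(H, 2)` for `H ≤ 𝓘_C²`. [cite: BierstoneGrigorievMilmanWlodarczyk2011, §3.2 Lemma 3.2.1] -/
theorem controlledTransform_one_le_two {E' E : Scheme.{u}} {τ : E' ⟶ E} {C H : E.IdealSheafData}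
    (hτ : IsBlowup τ C) (hle : H ≤ C ^ 2) :
    controlledTransform τ C H 1 ≤ controlledTransform τ C H 2 := by
  rw [controlledTransform_one_eq_exc_mul_two hτ hle]
  exact DepthTwo.mul_le_left' _ _

/-- **The diagonal flag law**: for `H ≤ 𝓘_C²` the transported second flag term of the diagonal flag `(H, H)` is again the
first, `τᶜ(H, 2) ⊔ τᶜ(H, 1) = τᶜ(H, 2)`. [cite: KawanoueMatsuki2016, §2 (transformation rule)] -/
theorem controlledTransform_two_sup_one {E' E : Scheme.{u}} {τ : E' ⟶ E} {C H : E.IdealSheafData}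
    (hτ : IsBlowup τ C) (hle : H ≤ C ^ 2) :
    controlledTransform τ C H 2 ⊔ controlledTransform τ C H 1 = controlledTransform τ C H 2 :=
  sup_eq_left.mpr (controlledTransform_one_le_two hτ hle)

/-- **The diagonal stays diagonal**: along any flag sequence started on the diagonal `𝔟 = R₁ = H` the second flag term equals
the first. [cite: KawanoueMatsuki2016, §2] -/
theorem IsFlagSeq.right_eq_of_diag :
    ∀ {E' E : Scheme.{u}} {ρ : E' ⟶ E} {H H₁ : E.IdealSheafData} {𝔟' R₁' : E'.IdealSheafData},
      IsFlagSeq ρ H H₁ 𝔟' R₁' → H₁ = H → R₁' = 𝔟'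
  | _, _, _, _, _, _, _, .nil _ _, h => h
  | _, _, _, _, _, _, _, .cons τ ρ _ _ 𝔟' R₁' C hseq _ hle _ hτ, h => by
    rw [IsFlagSeq.right_eq_of_diag hseq h]
    exact controlledTransform_two_sup_one hτ hle

/-- **Every pure weight-two sequence is a diagonal flag sequence** (`IsPureWeightedSeq 2 ρ H H' → IsFlagSeq ρ H H H' H'`): the
weight-two output `𝔟''` with `τ^*H' = 𝓘_exc² · 𝔟''` IS `τᶜ(H', 2)` (cancellation of the exceptional Cartier divisor), and the
flag's second law returns `τᶜ(H', 2)` on the diagonal. [cite: BierstoneGrigorievMilmanWlodarczyk2011, Def. 3.1.3, §3.2] -/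
theorem IsFlagSeq.of_isPureWeightedSeq :
    ∀ {E' E : Scheme.{u}} {ρ : E' ⟶ E} {H : E.IdealSheafData} {H' : E'.IdealSheafData},
      IsPureWeightedSeq 2 ρ H H' → IsFlagSeq ρ H H H' H'
  | _, _, _, _, _, .nil H => .nil H H
  | _, _, _, _, _, .cons τ ρ H H' H'' C hseq hC hle hτ heq => by
    have hct : controlledTransform τ C H' 2 = H'' := colon_pow_eq_of_mul_eq hτ.isEffectiveCartier heq.symm
    have h := IsFlagSeq.cons τ ρ H H H' H' C (IsFlagSeq.of_isPureWeightedSeq hseq) hC hle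
      (hle.trans (DepthTwo.sq_le_self' C)) hτ
    rwa [controlledTransform_two_sup_one hτ hle, hct] at h

/-- **`EndFlag` on the diagonal is «order at most one everywhere»**: `EndFlag H' H' ↔ ∀ x, idealOrder H' x ≤ 1`
(`H' ⊔ H'² = H'`). [cite: KawanoueMatsuki2016, §2] -/
theorem endFlag_self_iff {E : Scheme.{u}} (H' : E.IdealSheafData) :
    EndFlag H' H' ↔ ∀ x : E, idealOrder H' x ≤ 1 := by
  have h : H' ⊔ H' ^ 2 = H' := sup_eq_left.mpr (DepthTwo.sq_le_self' H')
  simp only [EndFlag, h]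

/-- **One-ideal currency for the residual** (conversion, fact-free): a pure weight-two sequence from `H` ending at an ideal of
order `≤ 1` everywhere is a diagonal flag sequence reaching `EndFlag` — exactly the `IsFlagSeq`/`EndFlag` clauses of idea-1's
`LegalDivisorReduction₃` / `LegalScopedDivisorReduction₃` (the `FlagState₃` clause is res-D-pv-021's `IsFlagSeq.flagState₃`).
[cite: BierstoneGrigorievMilmanWlodarczyk2011, §3.2] [cite: KawanoueMatsuki2016, §2] -/
theorem exists_isFlagSeq_endFlag_of_isPureWeightedSeq {E' E : Scheme.{u}} {ρ : E' ⟶ E} {H : E.IdealSheafData}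
    {H' : E'.IdealSheafData} (hseq : IsPureWeightedSeq 2 ρ H H') (hend : ∀ x : E', idealOrder H' x ≤ 1) :
    ∃ 𝔟' R₁' : E'.IdealSheafData, IsFlagSeq ρ H H 𝔟' R₁' ∧ 𝔟' = H' ∧ R₁' = H' ∧ EndFlag 𝔟' R₁' :=
  ⟨H', H', IsFlagSeq.of_isPureWeightedSeq hseq, rfl, rfl, (endFlag_self_iff H').mpr hend⟩

/-- Conversely, a flag sequence on the diagonal reaching `EndFlag` is a pure weight-two sequence ending at order `≤ 1`
(`IsFlagSeq.isPureWeightedSeq` + `right_eq_of_diag`). [cite: BierstoneGrigorievMilmanWlodarczyk2011, §3.2] -/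
theorem IsFlagSeq.isPureWeightedSeq_of_diag_endFlag {E' E : Scheme.{u}} {ρ : E' ⟶ E} {H : E.IdealSheafData}
    {𝔟' R₁' : E'.IdealSheafData} (hseq : IsFlagSeq ρ H H 𝔟' R₁') (hend : EndFlag 𝔟' R₁') :
    IsPureWeightedSeq 2 ρ H 𝔟' ∧ ∀ x : E', idealOrder 𝔟' x ≤ 1 := by
  have hR : R₁' = 𝔟' := hseq.right_eq_of_diag rfl
  subst hR
  exact ⟨hseq.isPureWeightedSeq, (endFlag_self_iff _).mp hend⟩

end Summit.ResolutionOfSingularities.ResolutionOfSingularities.Theorems.DepthTargets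

end
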